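import Summits.QuantumFields.BalabanUV.T4Continuum.Support.ShellMeasureDecayComplexRay

/-!
# `T4Continuum.ShellMeasureDecayComplexRayFirstOrder` — ROW S121 (J6) file 2: THE FIRST-ORDER REMAINDER BUDGET — a complex remainder
# supported on the diagonal and on the fine bonds with SCALE-ADAPTED entries `‖P((x,i),(y,i′))‖ ≤ β·min(1∕n(x), 1∕n(y))` costs the gap
# budget `4d·|Cp|·β·κ` sitewise on the scale of the gap itself (level-free), so E1∕E6 decay persists along the complex contraction ray
# with `μ₀ ↦ μ₀ − 4d|Cp|βκ`
(cell `pub-balaban`, sub-cell `t4`, spine estimate NE7c (node U5b); NE7c ROUND-2 crew `t4-ne7c-formalise-*`, unit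
`b2b-balaban-t4-ne7c-formalise-leaf-10` gen 15; owner table `t4/b2b-balaban-t4-ne7c-p1/LEAVES-NE7c-P1.md` ROW **S121 = J6** (GO R-ne7cp1-g37-10 (b)),
file 2 over file 1 `ShellMeasureDecayComplexRay` p243718; ADDITIVE — imports file 1 ONLY; [folklore]; theorems only, 0 `def`, 0 `def … : Prop`, 0 sorry,
0 citation tags; touches NO host; moves NO census row)

HONEST FRAMING.  Finite four-torus programme, rung (B)+1 only — NOT infinite volume, NOT a mass gap, NOT the Clay problem, NOT summit
progress; (B), `BetaPertHyp`, (B^μ) not consumed.  NE7c (`T4IndicatorShell.ShellWeightBound` for the cell's expansions) is NOT PRINTED in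
[Balaban 1983–89] and NOT PROVED; «NE7c ⇐ the named binders» (trigger c3).  This file is elementary bookkeeping on OUR side (Schur sums over
lattice neighbours, `|eˣ − 1| ≤ 2|x|`) turning file 1's DISPLAYED sitewise budget `hJ` into an ENTRYWISE, scale-adapted hypothesis on the
remainder; the entry bound `hPβ` and the accretivity `hP` stay DISPLAYED, asserted by nobody; nothing of Bałaban's is asserted, cited or
discharged (that the anti-Hermitian part of the complexified covariant operator of [Balaban1985BackgroundPropagators] (3.37) HAS such entries
is J1 (D7)'s READING, not a theorem here).  HONEST DEPENDENCY (cell): continuum YM on T⁴ ⇐ BetaPertH ∧ nine spine estimates (0/9 proved);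
BetaPertH ⇐ (D1) ∧ (D4) ∧ CAP+tail; G-an2-4 gates asym, D1 and NE2/3/4.

THE POINT.  File 1's END `decay_levelOp_add_complexRay` asks `½(expRowDefect P + expColDefect P)(κ, d_n(·,q))(e) ≤ θ·μ₀·n(e₁)⁻²`.  For a
remainder living on the diagonal (free: weight step `0`) and on the fine bonds with `‖P((x,i),(y,i′))‖ ≤ β·slen(x,y)`,
`slen(x,y) = min(1∕n(x), 1∕n(y))` (the scale-adapted bond length of `Beta/MultiscaleDistance`), each bond term costs
`β·slen·|e^{±κ·Δd_n} − 1| ≤ β·slen·2κ·slen ≤ 2βκ·n(x)⁻²` (one-step Lipschitz `|Δd_n| ≤ slen ≤ 1`, `κ ≤ 1`), and a site has at most `2d·|Cp|`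
fibre-neighbours, so BOTH defects are `≤ 4d|Cp|βκ·n⁻²` — the SAME power of the local scale as the gap `μ₀·n⁻²`.  Hence:
* §1 `expWeight_le_two_mul` (`|eˣ − 1| ≤ 2|x|` dressed), **`expRowDefect_le_of_bondBudget`** ∕ **`expColDefect_le_of_bondBudget`** (abstract bond
  structure `src tgt : Bd → St`, scale `n ≥ 1`, fibre `Cp`, degree bound `D`): `≤ 2·D·|Cp|·β·κ·n(e₁)⁻²`.
* §2 `card_adj_le_two_mul` — on the torus `UT N` with the bonds `(x, μ) : x → x + e_μ` every site has at most `2d` neighbours.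
* §3 THE END **`decay_levelOp_add_firstOrder`**: `MultiscaleDecay.decay_levelOp`'s binders + `P`, `hP : Re z^*Pz ≥ 0`, `hPsupp` (diagonal ∪ fine
  bonds), `hPβ` (entries `≤ β·slen`), `hβ : 0 ≤ β`, and the LEVEL-FREE smallness `4d·|Cp|·β·κ < μ₀` ⟹ `cmat levelOp + P` is a unit and
  **`‖(cmat levelOp + P)⁻¹(p,q)‖ ≤ e^{−κ·d_n(p,q)}·n(p)n(q)∕(μ₀ − 4d|Cp|βκ)`** — the remainder SUBTRACTS `4d|Cp|βκ` from the gap budget exactly as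
  the Laplacian's own conjugation cost `2d·c_max²κ²` does; **`decay_levelOp_add_firstOrder_cov`** the covariant-gauge instance (S119∕J4's datum).
NOT claimed: any bound on Bałaban's remainder; the sup member; sectioning.
-/

noncomputable section

open scoped BigOperators Matrix ComplexConjugate
open Finset Function Complex Matrix

namespace Summit.QuantumFields.BalabanUV.T4Continuum.ShellMeasureDecayComplexRayFirstOrder

open Summit.QuantumFields.BalabanUV.Beta
open Summit.QuantumFields.BalabanUV.Beta.BoxPoincare (Box)
open Summit.QuantumFields.BalabanUV.Beta.CovariantBoxPoincare (hol)
open Summit.QuantumFields.BalabanUV.Beta.MultiscaleCoerciveTorus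
open Summit.QuantumFields.BalabanUV.Beta.MultiscaleCoerciveTorusCov (multiscale_coercive_torus_cov)
open Summit.QuantumFields.BalabanUV.Beta.MultiscaleDecayBudget (siteScale one_le_siteScale)
open Summit.QuantumFields.BalabanUV.Beta.MultiscaleDistance (bondGraph slen slen_nonneg slen_le_left slen_le_right slen_le_one slen_comm sdist
  abs_sdist_tgt_sub_src_le)
open Summit.QuantumFields.BalabanUV.Beta.AccretiveCombesThomasBudget (expWeight expWeight_nonneg expRowDefect expColDefect)
open Summit.QuantumFields.BalabanUV.Beta.CovariantTowerMatrix (cmat)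
open Summit.QuantumFields.BalabanUV.T4Continuum.ShellMeasureDecayComplexRay (decay_levelOp_add_complexRay)
open Literature.MathematicalPhysics.QuantumFieldTheory.Balaban1983to89
open Literature.MathematicalPhysics.QuantumFieldTheory.Balaban1983to89.B9Thm37GluePU (bsrc btgt bsrc_apply btgt_apply up_eq_iff)
open Literature.MathematicalPhysics.QuantumFieldTheory.Balaban1983to89.B9Thm37GlueTorusCov (tblk torusComb)
open Literature.MathematicalPhysics.QuantumFieldTheory.Balaban1983to89.B9Thm37GlueTorusCovLevels (levelOp)
open Literature.MathematicalPhysics.QuantumFieldTheory.Balaban1983to89.B5Leibniz121 (up dn)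
open B5TorusCover (UT Ctr ctrU)

/-! ## §1 The bond budget: scale-adapted first-order entries cost `2·D·|Cp|·β·κ·n⁻²` sitewise -/

section BondBudget

variable {St Bd Cp : Type} [Fintype St] [Fintype Cp] (src tgt : Bd → St) (n : St → ℕ)

omit [Fintype St] in
/-- The one-step Lipschitz property for ADJACENT sites (either orientation): `|d_n(x,q) − d_n(y,q)| ≤ slen(x,y)`. [folklore] -/
theorem abs_sdist_sub_le_slen_of_adj {x y : St} (h : (bondGraph src tgt).Adj x y) (q : St) :
    |sdist src tgt n x q - sdist src tgt n y q| ≤ slen n x y := by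
  rw [bondGraph, SimpleGraph.fromRel_adj] at h
  obtain ⟨-, ⟨b, hb, hb'⟩ | ⟨b, hb, hb'⟩⟩ := h
  · subst hb; subst hb'
    rw [abs_sub_comm]
    exact abs_sdist_tgt_sub_src_le src tgt n b q
  · subst hb; subst hb'
    rw [slen_comm]
    exact abs_sdist_tgt_sub_src_le src tgt n b q

omit [Fintype St] in
/-- **One bond term**: scale `n ≥ 1`, `0 ≤ κ ≤ 1`, `β ≥ 0`, an exponent `|t| ≤ κ·slen(x,y)` and an entry `a ≤ β·slen(x,y)`:
`a·|eᵗ − 1| ≤ 2βκ·n(x)⁻²` (`|eᵗ − 1| ≤ 2|t|` for `|t| ≤ 1`, `slen ≤ min(1, 1∕n(x))`). [folklore] -/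
theorem bondTerm_le (hn : ∀ x, 1 ≤ n x) {κ β : ℝ} (hκ0 : 0 ≤ κ) (hκ1 : κ ≤ 1) (hβ : 0 ≤ β) (x y : St) {t a : ℝ}
    (ht : |t| ≤ κ * slen n x y) (ha : a ≤ β * slen n x y) :
    a * |Real.exp t - 1| ≤ 2 * β * κ * ((n x : ℝ) ^ 2)⁻¹ := by
  have hs0 := slen_nonneg n x y
  have hs1 := slen_le_one n hn x y
  have hsl := slen_le_left n x y
  have harg : |t| ≤ 1 := ht.trans (by nlinarith)
  have hw : |Real.exp t - 1| ≤ 2 * κ * slen n x y := (Real.abs_exp_sub_one_le harg).trans (by linarith)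
  calc a * |Real.exp t - 1| ≤ (β * slen n x y) * (2 * κ * slen n x y) := mul_le_mul ha hw (abs_nonneg _) (mul_nonneg hβ hs0)
    _ = 2 * β * κ * (slen n x y) ^ 2 := by ring
    _ ≤ 2 * β * κ * ((n x : ℝ)⁻¹) ^ 2 :=
        mul_le_mul_of_nonneg_left (pow_le_pow_left₀ hs0 hsl 2) (by positivity)
    _ = 2 * β * κ * ((n x : ℝ) ^ 2)⁻¹ := by rw [inv_pow]

/-- Counting fibre-neighbours: `Σ_{(y,i′)} 1[x ~ y]·c = |Cp|·#{y ~ x}·c ≤ |Cp|·D·c` for `c ≥ 0`. [folklore] -/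
theorem sum_adj_indicator_le [DecidableRel (bondGraph src tgt).Adj] {D : ℕ}
    (hdeg : ∀ x, (univ.filter fun y => (bondGraph src tgt).Adj x y).card ≤ D) (x : St) {c : ℝ} (hc : 0 ≤ c) :
    ∑ e' : St × Cp, (if (bondGraph src tgt).Adj x e'.1 then c else 0) ≤ (Fintype.card Cp : ℝ) * D * c := by
  have h := hdeg x
  calc ∑ e' : St × Cp, (if (bondGraph src tgt).Adj x e'.1 then c else 0)
      = ∑ y : St, ∑ _i : Cp, (if (bondGraph src tgt).Adj x y then c else 0) := Fintype.sum_prod_type _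
    _ = ∑ y : St, (Fintype.card Cp : ℝ) * (if (bondGraph src tgt).Adj x y then c else 0) :=
        Finset.sum_congr rfl fun y _ => by rw [Finset.sum_const, Finset.card_univ, nsmul_eq_mul]
    _ = (Fintype.card Cp : ℝ) * ∑ y ∈ univ.filter (fun y => (bondGraph src tgt).Adj x y), c := by
        rw [← Finset.mul_sum, Finset.sum_filter]
    _ = (Fintype.card Cp : ℝ) * (((univ.filter fun y => (bondGraph src tgt).Adj x y).card : ℝ) * c) := by
        rw [Finset.sum_const, nsmul_eq_mul]
    _ ≤ (Fintype.card Cp : ℝ) * ((D : ℝ) * c) :=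
        mul_le_mul_of_nonneg_left (mul_le_mul_of_nonneg_right (by exact_mod_cast h) hc) (by positivity)
    _ = (Fintype.card Cp : ℝ) * D * c := by ring

omit [Fintype St] [Fintype Cp] in
/-- The two off-support cases of a term `‖P e e′‖·expWeight`: on the diagonal-in-site the weight step vanishes, off the bonds `P` does.
[folklore] -/
theorem term_eq_zero_of_not_adj (P : Matrix (St × Cp) (St × Cp) ℂ)
    (hPsupp : ∀ e e', P e e' ≠ 0 → e.1 = e'.1 ∨ (bondGraph src tgt).Adj e.1 e'.1) (κ : ℝ) (q : St) {e e' : St × Cp}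
    (hadj : ¬(bondGraph src tgt).Adj e.1 e'.1) :
    ‖P e e'‖ * expWeight κ (fun e => sdist src tgt n e.1 q) e e' = 0 := by
  by_cases hP0 : P e e' = 0
  · rw [hP0, norm_zero, zero_mul]
  · rcases hPsupp e e' hP0 with hxy | hxy
    · have h0 : expWeight κ (fun e : St × Cp => sdist src tgt n e.1 q) e e' = 0 := by
        unfold expWeight
        simp only [hxy, sub_self, mul_zero, Real.exp_zero, abs_zero]
      rw [h0, mul_zero]
    · exact absurd hxy hadj

/-- **THE ROW DEFECT OF A BOND-SUPPORTED SCALE-ADAPTED REMAINDER**: `P` vanishes unless `y = x` or `x ~ y`, `‖P((x,i),(y,i′))‖ ≤ β·slen(x,y)` for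
`y ≠ x`, every site has at most `D` neighbours, `n ≥ 1`, `0 ≤ κ ≤ 1`, `β ≥ 0` ⟹ along the weight `d_n(·, q)`:
`expRowDefect P κ (d_n(·,q)) (x,i) ≤ 2·|Cp|·D·β·κ·n(x)⁻²`. [folklore] -/
theorem expRowDefect_le_of_bondBudget [DecidableRel (bondGraph src tgt).Adj] (hn : ∀ x, 1 ≤ n x) {D : ℕ}
    (hdeg : ∀ x, (univ.filter fun y => (bondGraph src tgt).Adj x y).card ≤ D)
    (P : Matrix (St × Cp) (St × Cp) ℂ) (hPsupp : ∀ e e', P e e' ≠ 0 → e.1 = e'.1 ∨ (bondGraph src tgt).Adj e.1 e'.1)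
    {β : ℝ} (hβ : 0 ≤ β) (hPβ : ∀ e e', e.1 ≠ e'.1 → ‖P e e'‖ ≤ β * slen n e.1 e'.1)
    {κ : ℝ} (hκ0 : 0 ≤ κ) (hκ1 : κ ≤ 1) (q : St) (e : St × Cp) :
    expRowDefect P κ (fun e => sdist src tgt n e.1 q) e ≤ 2 * (Fintype.card Cp) * D * β * κ * ((n e.1 : ℝ) ^ 2)⁻¹ := by
  unfold expRowDefect
  have hterm : ∀ e' : St × Cp, ‖P e e'‖ * expWeight κ (fun e => sdist src tgt n e.1 q) e e' ≤
      if (bondGraph src tgt).Adj e.1 e'.1 then 2 * β * κ * ((n e.1 : ℝ) ^ 2)⁻¹ else 0 := by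
    intro e'
    by_cases hadj : (bondGraph src tgt).Adj e.1 e'.1
    · rw [if_pos hadj]
      refine bondTerm_le n hn hκ0 hκ1 hβ e.1 e'.1 ?_ (hPβ e e' hadj.ne)
      rw [abs_mul, abs_of_nonneg hκ0]
      exact mul_le_mul_of_nonneg_left (abs_sdist_sub_le_slen_of_adj src tgt n hadj q) hκ0
    · rw [if_neg hadj, term_eq_zero_of_not_adj src tgt n P hPsupp κ q hadj]
  refine (Finset.sum_le_sum fun e' _ => hterm e').trans ?_
  refine (sum_adj_indicator_le src tgt hdeg e.1 (by positivity)).trans (le_of_eq ?_)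
  ring

/-- **THE COLUMN DEFECT OF A BOND-SUPPORTED SCALE-ADAPTED REMAINDER** (same bound at the column's site): `≤ 2·|Cp|·D·β·κ·n(y)⁻²`. [folklore] -/
theorem expColDefect_le_of_bondBudget [DecidableRel (bondGraph src tgt).Adj] (hn : ∀ x, 1 ≤ n x) {D : ℕ}
    (hdeg : ∀ x, (univ.filter fun y => (bondGraph src tgt).Adj x y).card ≤ D)
    (P : Matrix (St × Cp) (St × Cp) ℂ) (hPsupp : ∀ e e', P e e' ≠ 0 → e.1 = e'.1 ∨ (bondGraph src tgt).Adj e.1 e'.1)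
    {β : ℝ} (hβ : 0 ≤ β) (hPβ : ∀ e e', e.1 ≠ e'.1 → ‖P e e'‖ ≤ β * slen n e.1 e'.1)
    {κ : ℝ} (hκ0 : 0 ≤ κ) (hκ1 : κ ≤ 1) (q : St) (e' : St × Cp) :
    expColDefect P κ (fun e => sdist src tgt n e.1 q) e' ≤ 2 * (Fintype.card Cp) * D * β * κ * ((n e'.1 : ℝ) ^ 2)⁻¹ := by
  unfold expColDefect
  have hterm : ∀ e : St × Cp, ‖P e e'‖ * expWeight κ (fun e => sdist src tgt n e.1 q) e e' ≤
      if (bondGraph src tgt).Adj e'.1 e.1 then 2 * β * κ * ((n e'.1 : ℝ) ^ 2)⁻¹ else 0 := by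
    intro e
    by_cases hadj : (bondGraph src tgt).Adj e'.1 e.1
    · rw [if_pos hadj]
      refine bondTerm_le n hn hκ0 hκ1 hβ e'.1 e.1 ?_ (by rw [slen_comm]; exact hPβ e e' hadj.symm.ne)
      rw [abs_mul, abs_of_nonneg hκ0, slen_comm]
      exact mul_le_mul_of_nonneg_left (abs_sdist_sub_le_slen_of_adj src tgt n hadj.symm q) hκ0
    · rw [if_neg hadj, term_eq_zero_of_not_adj src tgt n P hPsupp κ q (fun h => hadj h.symm)]
  refine (Finset.sum_le_sum fun e _ => hterm e).trans ?_
  refine (sum_adj_indicator_le src tgt hdeg e'.1 (by positivity)).trans (le_of_eq ?_)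
  ring

end BondBudget

/-! ## §2 The torus: every site has at most `2d` neighbours -/

section TorusDegree

variable {d : ℕ} {N : Fin d → ℕ} [∀ i, NeZero (N i)]

/-- Adjacency in the torus bond graph: `y = x + e_μ` or `y = x − e_μ` for some axis `μ`. [folklore] -/
theorem adj_iff_up_or_dn (x y : UT N) :
    (bondGraph (bsrc (N := N)) btgt).Adj x y → ∃ μ : Fin d, y = up x μ ∨ y = dn x μ := by
  rw [bondGraph, SimpleGraph.fromRel_adj]
  rintro ⟨-, ⟨⟨z, μ⟩, hb, hb'⟩ | ⟨⟨z, μ⟩, hb, hb'⟩⟩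
  · rw [bsrc_apply] at hb; rw [btgt_apply] at hb'
    subst hb
    exact ⟨μ, Or.inl hb'.symm⟩
  · rw [bsrc_apply] at hb; rw [btgt_apply] at hb'
    subst hb
    exact ⟨μ, Or.inr ((up_eq_iff z x μ).1 hb')⟩

/-- **At most `2d` neighbours per site on the torus.** [folklore] -/
theorem card_adj_le_two_mul [DecidableRel (bondGraph (bsrc (N := N)) btgt).Adj] (x : UT N) :
    (univ.filter fun y => (bondGraph (bsrc (N := N)) btgt).Adj x y).card ≤ 2 * d := by
  classical
  have hsub : (univ.filter fun y => (bondGraph (bsrc (N := N)) btgt).Adj x y) ⊆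
      (univ.image fun μ : Fin d => up x μ) ∪ (univ.image fun μ : Fin d => dn x μ) := by
    intro y hy
    rw [Finset.mem_filter] at hy
    obtain ⟨μ, h | h⟩ := adj_iff_up_or_dn x y hy.2
    · exact Finset.mem_union_left _ (Finset.mem_image.2 ⟨μ, mem_univ _, h.symm⟩)
    · exact Finset.mem_union_right _ (Finset.mem_image.2 ⟨μ, mem_univ _, h.symm⟩)
  refine (Finset.card_le_card hsub).trans ((Finset.card_union_le _ _).trans ?_)
  have h1 : (univ.image fun μ : Fin d => up x μ).card ≤ d :=
    Finset.card_image_le.trans (by rw [Finset.card_univ, Fintype.card_fin])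
  have h2 : (univ.image fun μ : Fin d => dn x μ).card ≤ d :=
    Finset.card_image_le.trans (by rw [Finset.card_univ, Fintype.card_fin])
  omega

end TorusDegree

/-! ## §3 The END: first-order remainders subtract `4d·|Cp|·β·κ` from the gap budget -/

section End

variable {d : ℕ} {N : Fin d → ℕ} [∀ i, NeZero (N i)] [NeZero d] {Cp J K : Type} [Fintype Cp] [DecidableEq Cp] [Fintype J] [Fintype K]
  (S : J → ℕ) (hS : ∀ l, 1 ≤ S l) (hdivS : ∀ l i, S l ∣ N i) (lvl : K → J) (zc : (k : K) → Ctr N (S (lvl k)))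

/-- **E1∕E6 ALONG THE COMPLEX RAY WITH A FIRST-ORDER REMAINDER (MODEL).**  Setting of `MultiscaleDecay.decay_levelOp` + a complex remainder `P`
with `Re z^*Pz ≥ 0`, supported on the diagonal and the fine bonds, with scale-adapted entries `‖P((x,i),(y,i′))‖ ≤ β·slen_n(x,y)` (`β ≥ 0`), and
the LEVEL-FREE smallness `4d·|Cp|·β·κ < μ₀` (`μ₀ = C − 2d·c_max²κ² − a_max(e^{2dκ} − 1)`).  Then `cmat levelOp + P` is a unit and
`‖(cmat levelOp + P)⁻¹(p,q)‖ ≤ e^{−κ·d_n(p,q)}·n(p)n(q)∕(μ₀ − 4d|Cp|βκ)`. [folklore] -/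
theorem decay_levelOp_add_firstOrder
    (hdisj : ∀ k k' v v', cellPt S hS hdivS lvl zc k v = cellPt S hS hdivS lvl zc k' v' → k = k')
    (hcover : ∀ x : UT N, ∃ k, ∃ v : Box d (S (lvl k)), cellPt S hS hdivS lvl zc k v = x)
    (Rm : UT N × Fin d → Cp → Cp → ℝ) (hRm : ∀ b i j, ∑ k, Rm b k i * Rm b k j = if i = j then (1 : ℝ) else 0)
    (T : J → UT N → Cp → Cp → ℝ) (hT : ∀ l x i i', ∑ k, T l x k i * T l x k i' = if i = i' then (1 : ℝ) else 0)
    (a : J → ℝ) (ha : ∀ j, 0 ≤ a j) (ω : J → UT N → ℝ)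
    (hsupp : ∀ l x, ω l (ctrU N (S l) (tblk (hS l) (hdivS l) x)) ≠ 0 → ∃ k v, lvl k = l ∧ cellPt S hS hdivS lvl zc k v = x)
    {amax : ℝ} (hamax : 0 ≤ amax)
    (hscale : ∀ k, a (lvl k) * ω (lvl k) (ctrU N (S (lvl k)) (zc k)) ^ 2 * (S (lvl k) : ℝ) ^ d ≤ amax / (S (lvl k) : ℝ) ^ 2)
    (c : UT N × Fin d → ℝ) {cmax : ℝ} (hc : ∀ b, |c b| ≤ cmax) {C : ℝ}
    (hcoer : ∀ f : UT N × Cp → ℝ,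
      C * ∑ k, ((S (lvl k) : ℝ) ^ 2)⁻¹ * ∑ v : Box d (S (lvl k)), ∑ i, f (cellPt S hS hdivS lvl zc k v, i) ^ 2 ≤
        ∑ p, f p * levelOp bsrc btgt c Rm (fun l x => ctrU N (S l) (tblk (hS l) (hdivS l) x))
          (fun l x => ω l (ctrU N (S l) (tblk (hS l) (hdivS l) x))) T a f p)
    {κ : ℝ} (hκ0 : 0 ≤ κ) (hκ1 : κ ≤ 1) (hμ : 0 < C - 2 * d * cmax ^ 2 * κ ^ 2 - amax * (Real.exp (2 * d * κ) - 1))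
    (P : Matrix (UT N × Cp) (UT N × Cp) ℂ) (hP : ∀ z, 0 ≤ (star z ⬝ᵥ (P *ᵥ z)).re)
    (hPsupp : ∀ e e', P e e' ≠ 0 → e.1 = e'.1 ∨ (bondGraph (bsrc (N := N)) btgt).Adj e.1 e'.1) {β : ℝ} (hβ : 0 ≤ β)
    (hPβ : ∀ e e', e.1 ≠ e'.1 → ‖P e e'‖ ≤ β * slen (siteScale S hS hdivS lvl zc hcover) e.1 e'.1)
    (hsmall : 4 * d * (Fintype.card Cp) * β * κ < C - 2 * d * cmax ^ 2 * κ ^ 2 - amax * (Real.exp (2 * d * κ) - 1))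
    (p q : UT N × Cp) :
    IsUnit (cmat (levelOp bsrc btgt c Rm (fun l x => ctrU N (S l) (tblk (hS l) (hdivS l) x))
        (fun l x => ω l (ctrU N (S l) (tblk (hS l) (hdivS l) x))) T a) + P) ∧
      ‖(cmat (levelOp bsrc btgt c Rm (fun l x => ctrU N (S l) (tblk (hS l) (hdivS l) x))
          (fun l x => ω l (ctrU N (S l) (tblk (hS l) (hdivS l) x))) T a) + P)⁻¹ p q‖ ≤
        Real.exp (-(κ * sdist bsrc btgt (siteScale S hS hdivS lvl zc hcover) p.1 q.1)) *
          ((siteScale S hS hdivS lvl zc hcover p.1 : ℝ) * (siteScale S hS hdivS lvl zc hcover q.1 : ℝ)) /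
          (C - 2 * d * cmax ^ 2 * κ ^ 2 - amax * (Real.exp (2 * d * κ) - 1) - 4 * d * (Fintype.card Cp) * β * κ) := by
  classical
  set μ₀ := C - 2 * d * cmax ^ 2 * κ ^ 2 - amax * (Real.exp (2 * d * κ) - 1) with hμ₀
  set n := siteScale S hS hdivS lvl zc hcover with hn
  set θ : ℝ := 4 * d * (Fintype.card Cp) * β * κ / μ₀ with hθdef
  have hθ : θ < 1 := by rw [hθdef, div_lt_one hμ]; exact hsmall
  have hθμ : θ * μ₀ = 4 * d * (Fintype.card Cp) * β * κ := by rw [hθdef]; field_simp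
  have hJ : ∀ q' e : UT N × Cp,
      (expRowDefect P κ (fun e => sdist bsrc btgt n e.1 q'.1) e + expColDefect P κ (fun e => sdist bsrc btgt n e.1 q'.1) e) / 2 ≤
        θ * (μ₀ * ((n e.1 : ℝ) ^ 2)⁻¹) := by
    intro q' e
    have hr := expRowDefect_le_of_bondBudget bsrc btgt n (one_le_siteScale S hS hdivS lvl zc hcover) card_adj_le_two_mul P hPsupp hβ
      hPβ hκ0 hκ1 q'.1 e
    have hc' := expColDefect_le_of_bondBudget bsrc btgt n (one_le_siteScale S hS hdivS lvl zc hcover) card_adj_le_two_mul P hPsupp hβ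
      hPβ hκ0 hκ1 q'.1 e
    have e1 : θ * (μ₀ * ((n e.1 : ℝ) ^ 2)⁻¹) = 2 * (Fintype.card Cp) * ((2 * d : ℕ) : ℝ) * β * κ * ((n e.1 : ℝ) ^ 2)⁻¹ := by
      rw [← mul_assoc, hθμ]; push_cast; ring
    rw [e1]
    linarith
  have h := decay_levelOp_add_complexRay S hS hdivS lvl zc hdisj hcover Rm hRm T hT a ha ω hsupp hamax hscale c hc hcoer hκ0 hκ1 hμ P hP
    hθ hJ p q
  have e2 : (1 - θ) * μ₀ = μ₀ - 4 * d * (Fintype.card Cp) * β * κ := by rw [sub_mul, one_mul, hθμ]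
  rw [e2] at h
  exact h

/-- **The covariant-gauge instance** (`MultiscaleDecay.decay_levelOp_cov`'s setting — per-cube (3.35)-shape gauge datum `g hg ε hε hgauge hloss`,
ROW S119∕J4's — + the first-order remainder): decay with denominator `(1 − θ_g)·min(c_min²∕(4d), a_min∕4) − 2d·c_max²κ² − a_max(e^{2dκ} − 1) −
4d·|Cp|·β·κ`. [folklore] -/
theorem decay_levelOp_add_firstOrder_cov
    (hdisj : ∀ k k' v v', cellPt S hS hdivS lvl zc k v = cellPt S hS hdivS lvl zc k' v' → k = k')
    (hcover : ∀ x : UT N, ∃ k, ∃ v : Box d (S (lvl k)), cellPt S hS hdivS lvl zc k v = x)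
    (Rm : UT N × Fin d → Cp → Cp → ℝ) (hRm : ∀ b i j, ∑ k, Rm b k i * Rm b k j = if i = j then (1 : ℝ) else 0)
    (a : J → ℝ) (ha : ∀ j, 0 ≤ a j) (ω : J → UT N → ℝ)
    (hsupp : ∀ l x, ω l (ctrU N (S l) (tblk (hS l) (hdivS l) x)) ≠ 0 → ∃ k v, lvl k = l ∧ cellPt S hS hdivS lvl zc k v = x)
    {amin amax : ℝ} (hamin : 0 ≤ amin) (hamax : 0 ≤ amax)
    (hscale_lo : ∀ k, amin / (S (lvl k) : ℝ) ^ 2 ≤ a (lvl k) * ω (lvl k) (ctrU N (S (lvl k)) (zc k)) ^ 2 * (S (lvl k) : ℝ) ^ d)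
    (hscale_hi : ∀ k, a (lvl k) * ω (lvl k) (ctrU N (S (lvl k)) (zc k)) ^ 2 * (S (lvl k) : ℝ) ^ d ≤ amax / (S (lvl k) : ℝ) ^ 2)
    (c : UT N × Fin d → ℝ) {cmin cmax : ℝ} (hcmin : 0 < cmin) (hc_lo : ∀ b, cmin ≤ |c b|) (hc_hi : ∀ b, |c b| ≤ cmax)
    (g : (k : K) → Box d (S (lvl k)) → Cp → Cp → ℝ)
    (hg : ∀ k v i i', ∑ k', g k v k' i * g k v k' i' = if i = i' then (1 : ℝ) else 0) (ε : K → ℝ) (hε : ∀ k, 0 ≤ ε k)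
    (hgauge : ∀ k (v : Box d (S (lvl k))) (i : Fin d) (hv : (v i : ℕ) + 1 < S (lvl k)) (u : Cp → ℝ),
      ∑ a', (∑ j, (hol Rm (g k) (fun v i _ => (cellPt S hS hdivS lvl zc k v, i)) v i hv a' j -
        if a' = j then 1 else 0) * u j) ^ 2 ≤ ε k ^ 2 * ∑ j, u j ^ 2)
    {θg : ℝ} (hloss : ∀ k, 4 * ((d : ℝ) * (S (lvl k)) * ((S (lvl k) : ℝ) - 1)) * d * ε k ^ 2 +
      4 * ((d * (S (lvl k) - 1) : ℕ) * ε k) ^ 2 ≤ θg)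
    {κ : ℝ} (hκ0 : 0 ≤ κ) (hκ1 : κ ≤ 1)
    (hμ : 0 < (1 - θg) * min (cmin ^ 2 / (4 * d)) (amin / 4) - 2 * d * cmax ^ 2 * κ ^ 2 - amax * (Real.exp (2 * d * κ) - 1))
    (P : Matrix (UT N × Cp) (UT N × Cp) ℂ) (hP : ∀ z, 0 ≤ (star z ⬝ᵥ (P *ᵥ z)).re)
    (hPsupp : ∀ e e', P e e' ≠ 0 → e.1 = e'.1 ∨ (bondGraph (bsrc (N := N)) btgt).Adj e.1 e'.1) {β : ℝ} (hβ : 0 ≤ β)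
    (hPβ : ∀ e e', e.1 ≠ e'.1 → ‖P e e'‖ ≤ β * slen (siteScale S hS hdivS lvl zc hcover) e.1 e'.1)
    (hsmall : 4 * d * (Fintype.card Cp) * β * κ <
      (1 - θg) * min (cmin ^ 2 / (4 * d)) (amin / 4) - 2 * d * cmax ^ 2 * κ ^ 2 - amax * (Real.exp (2 * d * κ) - 1))
    (p q : UT N × Cp) :
    IsUnit (cmat (levelOp bsrc btgt c Rm (fun l x => ctrU N (S l) (tblk (hS l) (hdivS l) x))
        (fun l x => ω l (ctrU N (S l) (tblk (hS l) (hdivS l) x))) (fun l x => (torusComb (hS l) (hdivS l)).tr Rm x) a) + P) ∧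
      ‖(cmat (levelOp bsrc btgt c Rm (fun l x => ctrU N (S l) (tblk (hS l) (hdivS l) x))
          (fun l x => ω l (ctrU N (S l) (tblk (hS l) (hdivS l) x))) (fun l x => (torusComb (hS l) (hdivS l)).tr Rm x) a) + P)⁻¹
          p q‖ ≤
        Real.exp (-(κ * sdist bsrc btgt (siteScale S hS hdivS lvl zc hcover) p.1 q.1)) *
          ((siteScale S hS hdivS lvl zc hcover p.1 : ℝ) * (siteScale S hS hdivS lvl zc hcover q.1 : ℝ)) /
          ((1 - θg) * min (cmin ^ 2 / (4 * d)) (amin / 4) - 2 * d * cmax ^ 2 * κ ^ 2 - amax * (Real.exp (2 * d * κ) - 1) -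
            4 * d * (Fintype.card Cp) * β * κ) :=
  decay_levelOp_add_firstOrder S hS hdivS lvl zc hdisj hcover Rm hRm (fun l x => (torusComb (hS l) (hdivS l)).tr Rm x)
    (fun l x i i' => (torusComb (hS l) (hdivS l)).tr_orth Rm hRm x i i') a ha ω hsupp hamax hscale_hi c hc_hi
    (fun f => multiscale_coercive_torus_cov (Nat.one_le_iff_ne_zero.mpr (NeZero.ne d)) S hS hdivS Rm hRm a ha ω c hcmin hc_lo lvl zc
      hdisj hamin hscale_lo g hg ε hε hgauge hloss f)
    hκ0 hκ1 hμ P hP hPsupp hβ hPβ hsmall p q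

end End

end Summit.QuantumFields.BalabanUV.T4Continuum.ShellMeasureDecayComplexRayFirstOrder

end
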